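import Literature.IUT.LogVolume.DyadicPrimeResidueIsometryStable
import Literature.IUT.LogVolume.DyadicDiffTwoIsometryStable
import HarnessLib

/-!
# The residual dyadic class: the elementwise hypotheses of `DyadicPrimeResidueIsometryStable` hold at `ℚ₂(√c)`, `c ≡ 3 (mod 4)`

Classical local algebra (nothing disputed).  `DyadicPrimeResidueIsometryStable` proves that factorwise isometries FIX the maximal
order `(R_I)^∼` of `K ⊗_{ℚ_p} K` ([IUTchIV] Prop. 1.1 p. 9) under three ELEMENTWISE hypotheses on `K`: (i) every unit `w` has
`‖w − 1‖ < 1` (residue field `𝔽₂`), (ii) a uniformizer `π₁` (`‖y‖ < 1 ⇒ ‖y‖ ≤ ‖π₁‖`), (iii) some `x₀` with `‖x₀‖ ≤ ‖π₁‖⁻¹` and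
`‖Tr x₀‖ ≥ 1` (`d ≤ e`).  THIS FILE discharges (i)–(iii) on the quadratic members of the class — the setting of
`DyadicDiffTwoIsometryStable`: `[K : ℚ₂] = 2`, `K ∋ π` with `π² = c ∈ ℚ₂`, `‖c‖ = 1`, `‖1 + c‖ ≤ ¼` (`ℚ₂(√−1)`, `ℚ₂(√3)`) — with
`π₁ := 1 − π` and `x₀ := ½·(1 − π)` (`Tr(1) = 2`, `Tr(π) = 0`, `‖1 − π‖² = ½`), so the hypotheses of the general theorem are
INHABITED (inside `ℚ̄₂`: `exists_residualHypotheses`); with these data `DyadicPrimeResidue.congr_mem_normalizedPacket_of_isometry`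
specialises to the statement of `DyadicDiffTwo.congr_mem_normalizedPacket_of_isometry` (already landed; not restated here).
Use (abc-iut cell, R-J row Y-29b): non-vacuity certificate for the residual-class stability theorem.  CONTAINERS only; no side is
taken on [IUTchIII] Cor. 3.12.  Proof-only file (theorems, no definitions).
[cite: Mochizuki2012, IUTchIV Prop. 1.1 p. 9, Prop. 1.4 (i) p. 13] [cite: NeukirchANT1999, Ch. II (4.8)] [cite: SerreLocalFields1979, Ch. II §1]
-/

noncomputable section

open Metric Set Function
open scoped TensorProduct

namespace Literature.IUT.LogVolume

namespace DyadicPrimeResidue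

variable {K : Type} [NontriviallyNormedField K] [NormedAlgebra ℚ_[2] K] [IsUltrametricDist K] [ProperSpace K]
variable {π : K} {c : ℚ_[2]}

omit [IsUltrametricDist K] [ProperSpace K] in
/-- Coordinates along the basis `(1, π)`: `w = s·1 + t·π` with `s = w_0`, `t = w_1`. [cite: NeukirchANT1999, Ch. II (4.8)] -/
theorem eq_repr_combo (B : Module.Basis (Fin 2) ℚ_[2] K) (hB0 : B 0 = 1) (hB1 : B 1 = π) (w : K) :
    w = B.repr w 0 • (1 : K) + B.repr w 1 • π := by
  conv_lhs => rw [← B.sum_repr w]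
  rw [Fin.sum_univ_two, hB0, hB1]

/-- A `2`-adic number of norm `> 1` has norm `≥ 2` (value group `2^ℤ`). [cite: SerreLocalFields1979, Ch. II §1] -/
theorem padic_two_le_norm_of_one_lt {q : ℚ_[2]} (h : 1 < ‖q‖) : 2 ≤ ‖q‖ := by
  have hq : q ≠ 0 := fun h0 => by rw [h0, norm_zero] at h; exact not_lt.mpr zero_le_one h
  have hinv : ‖q⁻¹‖ < 1 := by rw [norm_inv]; exact inv_lt_one_of_one_lt₀ h
  have hle := DyadicDiffTwo.padic_norm_le_two_inv_of_lt_one hinv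
  rw [norm_inv] at hle
  have hqpos : 0 < ‖q‖ := norm_pos_iff.mpr hq
  exact (inv_le_inv₀ hqpos (by norm_num)).mp hle

/-! ## (i) Residue field `𝔽₂`: every unit is `≡ 1` -/

omit [ProperSpace K] in
/-- **Every unit `w` of `K` has `‖w − 1‖ < 1`** (`[K : ℚ₂] = 2`, `π² = c`, `‖c‖ = 1`, `‖1 + c‖ ≤ ¼`): write `w = s + tπ`; from
`max(‖s + t‖, ‖t‖·‖1 − π‖) = 1` and `‖1 − π‖ = 2^{−1/2} ∉ 2^ℤ` read `‖s + t‖ = 1`, `‖t‖·‖1 − π‖ < 1`; then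
`‖w − 1‖ = max(‖s + t − 1‖, ‖t‖·‖1 − π‖) ≤ max(½, ·) < 1`. [cite: NeukirchANT1999, Ch. II (4.8)] -/
theorem norm_sub_one_lt_one_of_norm_eq_one (hK : Module.finrank ℚ_[2] K = 2) (hπ : π ^ 2 = algebraMap ℚ_[2] K c)
    (hc : ‖c‖ = 1) (hc1 : ‖1 + c‖ ≤ 4⁻¹) {w : K} (hw : ‖w‖ = 1) : ‖w - 1‖ < 1 := by
  obtain ⟨B, hB0, hB1⟩ := DyadicDiffTwo.exists_basis hK hπ hc hc1
  have hN := DyadicDiffTwo.norm_one_sub_pi_sq hπ hc hc1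
  have hN1 := DyadicDiffTwo.norm_one_sub_pi_lt_one hπ hc hc1
  set s := B.repr w 0 with hs
  set t := B.repr w 1 with ht
  have hw' : w = s • (1 : K) + t • π := eq_repr_combo B hB0 hB1 w
  have hmax : max ‖s + t‖ (‖t‖ * ‖1 - π‖) = 1 := by rw [← DyadicDiffTwo.norm_combo hπ hc hc1, ← hw', hw]
  -- `‖t‖·‖1 − π‖ ≠ 1`, hence `< 1`
  have hBlt : ‖t‖ * ‖1 - π‖ < 1 := by
    refine lt_of_le_of_ne ((le_max_right _ _).trans_eq hmax) fun h1 => ?_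
    rcases eq_or_ne t 0 with h0 | h0
    · rw [h0, norm_zero, zero_mul] at h1; exact zero_ne_one h1
    · obtain ⟨m, hm⟩ := DyadicDiffTwo.padic_exists_norm_eq_zpow h0
      exact DyadicDiffTwo.zpow_ne_zpow_mul hN 0 m (by rw [zpow_zero, ← hm, h1])
  have hA : ‖s + t‖ = 1 := by
    rcases max_choice ‖s + t‖ (‖t‖ * ‖1 - π‖) with h | h
    · rw [← h, hmax]
    · rw [h] at hmax; exact absurd hmax hBlt.ne
  have e1 : s • (1 : K) + t • π - 1 = (s - 1) • (1 : K) + t • π := by module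
  rw [hw', e1, DyadicDiffTwo.norm_combo hπ hc hc1]
  refine max_lt ?_ hBlt
  have h := DyadicDiffTwo.padic_norm_sub_one_le hA
  rw [show s + t - 1 = s - 1 + t by ring] at h
  exact h.trans_lt (by norm_num)

/-! ## (ii) `1 − π` is a uniformizer -/

omit [ProperSpace K] in
/-- **`‖y‖ < 1 ⇒ ‖y‖ ≤ ‖1 − π‖`**: with `y = s + tπ`, `‖s + t‖ < 1` gives `‖s + t‖ ≤ ½ < ‖1 − π‖`, and `‖t‖·‖1 − π‖ < 1` forces
`‖t‖ ≤ 1` (else `‖t‖ ≥ 2` and `2‖1 − π‖ > 1`). [cite: NeukirchANT1999, Ch. II (4.8)] [cite: SerreLocalFields1979, Ch. II §1] -/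
theorem norm_le_norm_one_sub_pi_of_lt_one (hK : Module.finrank ℚ_[2] K = 2) (hπ : π ^ 2 = algebraMap ℚ_[2] K c)
    (hc : ‖c‖ = 1) (hc1 : ‖1 + c‖ ≤ 4⁻¹) {y : K} (hy : ‖y‖ < 1) : ‖y‖ ≤ ‖1 - π‖ := by
  obtain ⟨B, hB0, hB1⟩ := DyadicDiffTwo.exists_basis hK hπ hc hc1
  have h2N := DyadicDiffTwo.two_inv_lt_norm_one_sub_pi hπ hc hc1
  have hN0 : 0 < ‖1 - π‖ := lt_trans (by norm_num) h2N
  set s := B.repr y 0 with hs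
  set t := B.repr y 1 with ht
  have hy' : y = s • (1 : K) + t • π := eq_repr_combo B hB0 hB1 y
  rw [hy', DyadicDiffTwo.norm_combo hπ hc hc1] at hy ⊢
  obtain ⟨hA, hB⟩ := max_lt_iff.mp hy
  refine max_le ((DyadicDiffTwo.padic_norm_le_two_inv_of_lt_one hA).trans h2N.le) ?_
  have ht1 : ‖t‖ ≤ 1 := by
    by_contra hgt
    rw [not_le] at hgt
    have h2 := padic_two_le_norm_of_one_lt hgt
    have : (1 : ℝ) < ‖t‖ * ‖1 - π‖ :=
      calc (1 : ℝ) = 2 * 2⁻¹ := by norm_num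
        _ < 2 * ‖1 - π‖ := by gcongr
        _ ≤ ‖t‖ * ‖1 - π‖ := by gcongr
    exact not_lt.mpr this.le hB
  calc ‖t‖ * ‖1 - π‖ ≤ 1 * ‖1 - π‖ := by gcongr
    _ = ‖1 - π‖ := one_mul _

/-! ## (iii) The trace datum `x₀ = ½·(1 − π)` -/

omit [ProperSpace K] in
/-- `Tr_{K/ℚ₂}(π) = 0` (the matrix of `π` on `(1, π)` is `[[0, c], [1, 0]]`). [cite: NeukirchANT1999, Ch. II (4.8)] -/
theorem trace_pi_eq_zero (hK : Module.finrank ℚ_[2] K = 2) (hπ : π ^ 2 = algebraMap ℚ_[2] K c) (hc : ‖c‖ = 1)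
    (hc1 : ‖1 + c‖ ≤ 4⁻¹) : Algebra.trace ℚ_[2] K π = 0 := by
  classical
  obtain ⟨B, hB0, hB1⟩ := DyadicDiffTwo.exists_basis hK hπ hc hc1
  rw [Algebra.trace_eq_matrix_trace B, Matrix.trace, Fin.sum_univ_two, Matrix.diag_apply, Matrix.diag_apply,
    Algebra.leftMulMatrix_eq_repr_mul, Algebra.leftMulMatrix_eq_repr_mul, hB0, mul_one]
  have h1 : B.repr π 0 = 0 := by
    rw [← hB1, B.repr_self, Finsupp.single_eq_of_ne (by decide)]
  have h2 : B.repr (π * B 1) 1 = 0 := by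
    rw [hB1, ← sq, hπ, Algebra.algebraMap_eq_smul_one, ← hB0, map_smul, B.repr_self, Finsupp.smul_apply,
      Finsupp.single_eq_of_ne (by decide), smul_zero]
  rw [h1, h2, add_zero]

/-- **The trace datum**: `x₀ := ½·(1 − π)` has `‖x₀‖ = 2‖1 − π‖ = ‖1 − π‖⁻¹` (`‖1 − π‖² = ½`) and `Tr x₀ = ½·(2 − 0) = 1`.
[cite: NeukirchANT1999, Ch. II (4.8)] [cite: SerreLocalFields1979, Ch. III §3, Prop. 7] -/
theorem traceDatum (hK : Module.finrank ℚ_[2] K = 2) (hπ : π ^ 2 = algebraMap ℚ_[2] K c) (hc : ‖c‖ = 1) (hc1 : ‖1 + c‖ ≤ 4⁻¹) :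
    ‖(2 : ℚ_[2])⁻¹ • (1 - π)‖ ≤ ‖1 - π‖⁻¹ ∧ 1 ≤ ‖Algebra.trace ℚ_[2] K ((2 : ℚ_[2])⁻¹ • (1 - π))‖ := by
  haveI : FiniteDimensional ℚ_[2] K := finiteDimensional 2 K
  have hN := DyadicDiffTwo.norm_one_sub_pi_sq hπ hc hc1
  have h2 : ‖(2 : ℚ_[2])‖ = 2⁻¹ := by
    have h := Padic.norm_p (p := 2)
    exact_mod_cast h
  constructor
  · refine le_of_eq (eq_inv_of_mul_eq_one_left ?_)
    rw [norm_smul, norm_inv, h2, inv_inv, mul_assoc, ← sq, hN]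
    norm_num
  · rw [map_smul, map_sub, trace_pi_eq_zero hK hπ hc hc1, sub_zero, show (1 : K) = algebraMap ℚ_[2] K 1 from (map_one _).symm,
      Algebra.trace_algebraMap, hK, nsmul_eq_mul, Nat.cast_ofNat, mul_one, smul_eq_mul, inv_mul_cancel₀ (two_ne_zero' ℚ_[2]),
      norm_one]

/-! ## Non-vacuity inside `ℚ̄₂` -/

/-- **NON-VACUITY of the residual-class hypotheses inside `ℚ̄₂`**: for every `c ∈ ℚ₂` with `‖c‖ = 1`, `‖1 + c‖ ≤ ¼` there is a finite
`E ⊆ ℚ̄₂`, `[E : ℚ₂] = 2`, `E ∋ √c`, in which (i) every unit `w` has `‖w − 1‖ < 1`, (ii) `‖y‖ < 1 ⇒ ‖y‖ ≤ ‖1 − √c‖`, and (iii)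
`x₀ = ½(1 − √c)` has `‖x₀‖ ≤ ‖1 − √c‖⁻¹`, `‖Tr x₀‖ ≥ 1` (`DyadicDiffTwo.exists_subfield`). [cite: NeukirchANT1999, Ch. II (4.8)] -/
theorem exists_residualHypotheses (c : ℚ_[2]) (hc : ‖c‖ = 1) (hc1 : ‖1 + c‖ ≤ 4⁻¹) :
    ∃ (E : IntermediateField ℚ_[2] (PadicAlgCl 2)) (_ : FiniteDimensional ℚ_[2] E) (π : E),
      Module.finrank ℚ_[2] E = 2 ∧ π ^ 2 = algebraMap ℚ_[2] E c ∧
        (∀ w : E, ‖w‖ = 1 → ‖w - 1‖ < 1) ∧ (∀ y : E, ‖y‖ < 1 → ‖y‖ ≤ ‖1 - π‖) ∧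
          ‖(2 : ℚ_[2])⁻¹ • (1 - π)‖ ≤ ‖1 - π‖⁻¹ ∧ 1 ≤ ‖Algebra.trace ℚ_[2] E ((2 : ℚ_[2])⁻¹ • (1 - π))‖ := by
  obtain ⟨E, π, hfd, hK, hπ⟩ := DyadicDiffTwo.exists_subfield c hc hc1
  haveI := hfd
  obtain ⟨hx₀, htr₀⟩ := traceDatum (K := E) hK hπ hc hc1
  exact ⟨E, hfd, π, hK, hπ, fun w hw => norm_sub_one_lt_one_of_norm_eq_one hK hπ hc hc1 hw,
    fun y hy => norm_le_norm_one_sub_pi_of_lt_one hK hπ hc hc1 hy, hx₀, htr₀⟩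

end DyadicPrimeResidue

end Literature.IUT.LogVolume

end
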